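import Summits.ResolutionOfSingularities.ResolutionOfSingularities.Theorems.PurelyInseparableDim4ParamCertSix
import Summits.ResolutionOfSingularities.ResolutionOfSingularities.Theorems.PurelyInseparableDim4ParamCertTreeSound
import Summits.ResolutionOfSingularities.ResolutionOfSingularities.Theorems.PurelyInseparableDim4MohAlong
import HarnessLib

/-!
# [OURS · res-dim4-pi · F4-C-loc] PARAMETRIC CERTIFICATES, format v6 (part 2: SOUNDNESS): a checked v6 table certifies, for
  every row, every value `β ≠ 0` of the fibre letter and every bookkeeping, an A-win of the LOCAL in-scope game over
  every field of the characteristic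

Cell `res-dim4-pi` (D-0157 DOOR 2, wave 2), seat `res-dim4-p-6` g4; sequel of `…ParamCertSix` (format v6).

* §1 glue: `pwin_of_memRow6B`; point decompositions `eq_update_add_single`, `eq_update2_add_pair`, `vanish_erase_of_eq`,
  `vanish_update_erase`, `vanish_update2_erase`.
* §2 **`pnode6_sound`** — the invariant of the v6 tree: current data `G`, current letter value `β ≠ 0`, and the polynomial
  `X = spec f β (evalT G)` = the chart transform translated by the coordinates pinned so far; every further translation `b`
  vanishing off `U` at which all low coefficients of `X` vanish and whose cleaned polynomial is non-zero gives a won state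
  (any bookkeeping).  By height (`pheight6`): `dead` (`coeff_ne_zero_of_pwitB`), `child` (`deletePthPowers_spec`, later
  row), `free` (`translate_single_spec`; `MohAlong.translate_translate` splits `b`), `roots` (`coord_cases_of_prootsMB`;
  monomial root by `translate_mono_spec`, quadratic by `spec_reduceQ` + letter-freeness), `pair` (`coord_eq_of_ppairB`
  + `translate_pair_spec`), `rel` / `split` (`exists_zero_of_prelB` / `exists_zero_of_psplitB`); `evalT_normT` throughout.
* §3 **`pwin_of_pcert6B`** and the entry point **`rWins_liftState_of_pcert6B`** (an `𝔽₃` state whose `embed` heads a checked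
  v6 table is a local A-win over EVERY field of characteristic 3).

[OURS · counted 0 · certificate soundness; AI kernel work, weaker than expert review.]  NOTHING here is a statement about
resolution of singularities; resolution in dimension `≥ 4` / characteristic `p > 0` is NOT proved by anything in this
file.  bears_on: LADDER-RESOLUTION:D157-DOOR2 (res-dim4-pi · F4-C-loc all fields · parametric rows v6).  Host item
(DR-157-C): `stmt-ResolutionOfSingularities-16155`, helper.
-/

set_option linter.dupNamespace false -- mandated namespace of this single-conjunct summit

noncomputable section

open MvPolynomial Finset
open scoped BigOperators

namespace Summit.ResolutionOfSingularities.ResolutionOfSingularities.Theorems.PIDim4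

namespace LoopCLocal

open Literature.AlgebraicGeometry.Resolution
open Literature.AlgebraicGeometry.Resolution.Hauser2010
open Literature.AlgebraicGeometry.Resolution.CentreBlowup
open StepKit ParamLift

variable {k K : Type} [Field k] [Field K] [DecidableEq k] [DecidableEq K] (f : k →+* K)

/-! ## §1 Glue -/

/-- a later row presenting the same polynomial certifies it. OURS. [folklore] -/
theorem pwin_of_memRow6B {q : ℕ} {rest : List (PRow6 k)}
    (hrest : ∀ row ∈ rest, (∀ β : K, β ≠ 0 → ∀ (r : Fin 4 →₀ ℕ) (exc : Finset (Fin 4)),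
      RWins q localB (⟨spec f β (evalT row.1), r, exc⟩ : State K))) {L : Terms 5 k}
    (h : memRow6B L rest = true) :
    (∀ β : K, β ≠ 0 → ∀ (r : Fin 4 →₀ ℕ) (exc : Finset (Fin 4)),
      RWins q localB (⟨spec f β (evalT L), r, exc⟩ : State K)) := by
  obtain ⟨r, hr, hrc⟩ := List.any_eq_true.mp h
  intro β hβ rr exc
  rw [(evalT_eq_iff_equivB _ _).mpr hrc]
  exact hrest r hr β hβ rr exc

omit [DecidableEq K] in
/-- a point splits off its `i`-th coordinate. OURS. [folklore] -/
theorem eq_update_add_single (b : Fin 4 → K) (i : Fin 4) : b = Function.update b i 0 + Pi.single i (b i) := by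
  funext m
  rw [Pi.add_apply]
  by_cases hm : m = i
  · subst hm; rw [Function.update_self, Pi.single_eq_same, zero_add]
  · rw [Function.update_of_ne hm, Pi.single_eq_of_ne hm, add_zero]

omit [DecidableEq K] in
/-- a point with the pair tie splits off the pair point. OURS. [folklore] -/
theorem eq_update2_add_pair {b : Fin 4 → K} {i i' : Fin 4} (hii' : i ≠ i') {c : K} (htie : b i = c) :
    b = Function.update (Function.update b i' 0) i 0 + (Pi.single i' (b i') + Pi.single i c) := by
  funext m
  rw [Pi.add_apply, Pi.add_apply]
  by_cases hm : m = i
  · subst hm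
    rw [Function.update_self, Pi.single_eq_same, Pi.single_eq_of_ne hii', zero_add, zero_add, htie]
  · rw [Function.update_of_ne hm, Pi.single_eq_of_ne hm, add_zero]
    by_cases hm' : m = i'
    · subst hm'; rw [Function.update_self, Pi.single_eq_same, zero_add]
    · rw [Function.update_of_ne hm', Pi.single_eq_of_ne hm', add_zero]

omit [DecidableEq K] in
/-- pinning a free coordinate to `0` keeps the vanishing pattern. OURS. [folklore] -/
theorem vanish_erase_of_eq {U : Finset (Fin 4)} {b : Fin 4 → K} (hb : ∀ m : Fin 4, m ∉ U → b m = 0) {i : Fin 4}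
    (hbi : b i = 0) : ∀ m : Fin 4, m ∉ U.erase i → b m = 0 := by
  intro m hm
  by_cases hmi : m = i
  · rw [hmi]; exact hbi
  · exact hb m fun hmU => hm (Finset.mem_erase.mpr ⟨hmi, hmU⟩)

omit [DecidableEq K] in
/-- the remainder after splitting off the `i`-th coordinate vanishes off `U ∖ {i}`. OURS. [folklore] -/
theorem vanish_update_erase {U : Finset (Fin 4)} {b : Fin 4 → K} (hb : ∀ m : Fin 4, m ∉ U → b m = 0) (i : Fin 4) :
    ∀ m : Fin 4, m ∉ U.erase i → Function.update b i 0 m = 0 := by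
  intro m hm
  by_cases hmi : m = i
  · rw [hmi, Function.update_self]
  · rw [Function.update_of_ne hmi]; exact hb m fun hmU => hm (Finset.mem_erase.mpr ⟨hmi, hmU⟩)

omit [DecidableEq K] in
/-- the remainder after splitting off the pair point vanishes off `U ∖ {i, i'}`. OURS. [folklore] -/
theorem vanish_update2_erase {U : Finset (Fin 4)} {b : Fin 4 → K} (hb : ∀ m : Fin 4, m ∉ U → b m = 0) (i i' : Fin 4) :
    ∀ m : Fin 4, m ∉ (U.erase i).erase i' → Function.update (Function.update b i' 0) i 0 m = 0 := by
  intro m hm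
  by_cases hmi : m = i
  · rw [hmi, Function.update_self]
  · rw [Function.update_of_ne hmi]
    by_cases hmi' : m = i'
    · rw [hmi', Function.update_self]
    · rw [Function.update_of_ne hmi']
      exact hb m fun hmU => hm (Finset.mem_erase.mpr ⟨hmi', Finset.mem_erase.mpr ⟨hmi, hmU⟩⟩)

/-! ## §2 Soundness of the v6 trees -/

section Tree

variable {q : ℕ} {rest : List (PRow6 k)}

/-- **soundness of a v6 tree** (by height; the invariant is in the module docstring). OURS. [folklore] -/
theorem pnode6_sound_aux
    (hrest : ∀ row ∈ rest, (∀ β : K, β ≠ 0 → ∀ (r : Fin 4 →₀ ℕ) (exc : Finset (Fin 4)),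
      RWins q localB (⟨spec f β (evalT row.1), r, exc⟩ : State K))) (n : ℕ) :
    ∀ (t : PNode6 k), pheight6 t < n → ∀ (G : Terms 5 k) (U : Finset (Fin 4)) (β : K) (X : MvPolynomial (Fin 4) K),
      β ≠ 0 → spec f β (evalT G) = X → pnode6B q rest G U t = true →
      ∀ b : Fin 4 → K, (∀ m : Fin 4, m ∉ U → b m = 0) →
        (∀ γ : Fin 4 → ℕ, γ ≠ 0 → (∑ i, γ i) < q → coeff (expo γ) (PointBlowup.translate b X) = 0) →
        deletePthPowers q (PointBlowup.translate b X) ≠ 0 →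
        ∀ (r : Fin 4 →₀ ℕ) (exc : Finset (Fin 4)),
          RWins q localB (⟨deletePthPowers q (PointBlowup.translate b X), r, exc⟩ : State K) := by
  induction n with
  | zero => intro t ht; exact absurd ht (Nat.not_lt_zero _)
  | succ n ih =>
  intro t ht G U β X hβ hX h b hb hlow hne r exc
  cases t with
  | dead γ =>
    simp only [pnode6B] at h
    have hnz := coeff_ne_zero_of_pwitB f β hβ h hb
    rw [hX] at hnz
    exact absurd (hlow γ (pwitB_low h).1 (pwitB_low h).2) hnz
  | child =>
    simp only [pnode6B, Bool.and_eq_true, decide_eq_true_eq] at h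
    obtain ⟨hU, hchild⟩ := h
    subst hU
    have hb0 := eq_zero_of_vanish hb
    subst hb0
    rw [PointBlowup.translate_zero] at hne ⊢
    have hF : deletePthPowers q X = spec f β (evalT (clean4 q G)) := by rw [← hX, deletePthPowers_spec]
    unfold pchild6B at hchild
    rw [Bool.or_eq_true] at hchild
    rcases hchild with hzero | hmem
    · exfalso; apply hne; rw [hF, (evalT_eq_zero_iff _).mpr hzero, map_zero]
    · rw [hF]; exact pwin_of_memRow6B f hrest hmem β hβ r exc
  | free i zero letter =>
    simp only [pnode6B, Bool.and_eq_true, decide_eq_true_eq] at h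
    obtain ⟨⟨⟨-, htf⟩, hzero⟩, hletter⟩ := h
    rw [pheight6] at ht
    by_cases hbi : b i = 0
    · exact ih zero (by omega) G (U.erase i) β X hβ hX hzero b (vanish_erase_of_eq hb hbi) hlow hne r exc
    · have hX' : spec f (b i) (evalT (normT (shearL i G))) = PointBlowup.translate (Pi.single i (b i)) X := by
        rw [evalT_normT, ← shearAlg_evalT, ← translate_single_spec, spec_eq_of_tfree f htf (b i) β, hX]
      have htr : PointBlowup.translate b X =
          PointBlowup.translate (Function.update b i 0) (PointBlowup.translate (Pi.single i (b i)) X) := by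
        rw [MohAlong.translate_translate, ← eq_update_add_single]
      rw [htr] at hlow hne ⊢
      exact ih letter (by omega) _ (U.erase i) (b i) _ hbi hX' hletter _ (vanish_update_erase hb i) hlow hne r exc
  | roots γ i tr M A d₀ zero rts qds =>
    simp only [pnode6B, Bool.and_eq_true, Bool.or_eq_true, decide_eq_true_eq] at h
    obtain ⟨⟨⟨⟨hroots, hz⟩, hrts⟩, htfq⟩, hqds⟩ := h
    rw [pheight6] at ht
    have hcases := coord_cases_of_prootsMB f β hβ hroots hb
      (by rw [hX]; exact hlow γ (prootsMB_low hroots).1 (prootsMB_low hroots).2)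
    rcases hcases with ⟨hd₀, hbi⟩ | ⟨ρm, hρm, hbi⟩ | ⟨htr, c, hc, hbi⟩
    · have hzero : pnode6B q rest G (U.erase i) zero = true := hz.resolve_left (by omega)
      exact ih zero (by omega) G (U.erase i) β X hβ hX hzero b (vanish_erase_of_eq hb hbi) hlow hne r exc
    · obtain ⟨⟨ρm', t'⟩, hmem, hfst⟩ := List.mem_map.mp hρm
      simp only at hfst
      subst hfst
      have hnode := pnode6B_of_mem_roots rts hrts ρm' t' hmem
      have hlt : pheight6 t' < n := by have := pheight6_le_of_memR rts ρm' t' hmem; omega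
      have hX' : spec f β (evalT (normT (shearMonoL i ρm'.1 tr G))) =
          PointBlowup.translate (Pi.single i (b i)) X := by
        rw [evalT_normT, ← shearMonoAlg_evalT, ← translate_mono_spec, hX, hbi]
      have htr : PointBlowup.translate b X =
          PointBlowup.translate (Function.update b i 0) (PointBlowup.translate (Pi.single i (b i)) X) := by
        rw [MohAlong.translate_translate, ← eq_update_add_single]
      rw [htr] at hlow hne ⊢
      exact ih t' hlt _ (U.erase i) β _ hβ hX' hnode _ (vanish_update_erase hb i) hlow hne r exc
    · obtain ⟨⟨c', t'⟩, hmem, hfst⟩ := List.mem_map.mp hc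
      simp only at hfst
      subst hfst
      obtain ⟨htf', hnode⟩ := pnode6B_of_mem_quads qds hqds c' t' hmem
      have hlt : pheight6 t' < n := by have := pheight6_le_of_memQ qds c' t' hmem; omega
      have htfG : tfreeB G = true :=
        htfq.resolve_left (by intro h0; rw [h0] at hmem; exact List.not_mem_nil hmem)
      have hX' : spec f β (evalT (normT (reduceQ c'.1 c'.2.1 (shearL i G)))) =
          PointBlowup.translate (Pi.single i (b i)) X := by
        rw [spec_eq_of_tfree f htf' β (b i), evalT_normT, spec_reduceQ f c'.1 c'.2.1 hbi, ← shearAlg_evalT,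
          ← translate_single_spec, spec_eq_of_tfree f htfG (b i) β, hX]
      have htr : PointBlowup.translate b X =
          PointBlowup.translate (Function.update b i 0) (PointBlowup.translate (Pi.single i (b i)) X) := by
        rw [MohAlong.translate_translate, ← eq_update_add_single]
      rw [htr] at hlow hne ⊢
      exact ih t' hlt _ (U.erase i) β _ hβ hX' hnode _ (vanish_update_erase hb i) hlow hne r exc
  | pair γ i i' ρ d zero letter =>
    simp only [pnode6B, Bool.and_eq_true] at h
    obtain ⟨⟨⟨htf, hpair⟩, hzero⟩, hletter⟩ := h
    rw [pheight6] at ht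
    have htie := coord_eq_of_ppairB f β hβ hpair hb
      (by rw [hX]; exact hlow γ (ppairB_low hpair).1 (ppairB_low hpair).2)
    have hii' := ppairB_ne hpair
    by_cases hbi' : b i' = 0
    · exact ih zero (by omega) G (U.erase i') β X hβ hX hzero b (vanish_erase_of_eq hb hbi') hlow hne r exc
    · have hX' : spec f (b i') (evalT (normT (shearMonoL i ρ d (shearL i' G)))) =
          PointBlowup.translate (Pi.single i' (b i') + Pi.single i (f ρ * b i' ^ d)) X := by
        rw [evalT_normT, ← shearMonoAlg_evalT, ← shearAlg_evalT, ← translate_pair_spec f (b i') hii',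
          spec_eq_of_tfree f htf (b i') β, hX]
      have htr : PointBlowup.translate b X = PointBlowup.translate (Function.update (Function.update b i' 0) i 0)
          (PointBlowup.translate (Pi.single i' (b i') + Pi.single i (f ρ * b i' ^ d)) X) := by
        rw [MohAlong.translate_translate, ← eq_update2_add_pair hii' htie]
      rw [htr] at hlow hne ⊢
      exact ih letter (by omega) _ ((U.erase i).erase i') (b i') _ hbi' hX' hletter _ (vanish_update2_erase hb i i')
        hlow hne r exc
  | rel γ γ' zs nu κ subs =>
    simp only [pnode6B, Bool.and_eq_true, decide_eq_true_eq] at h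
    obtain ⟨⟨hrel, hcov⟩, hforest⟩ := h
    rw [pheight6] at ht
    obtain ⟨i, hi, hbi⟩ := exists_zero_of_prelB f β hβ hrel hb
      (by rw [hX]; exact hlow γ (prelB_low hrel).1.1 (prelB_low hrel).1.2)
      (by rw [hX]; exact hlow γ' (prelB_low hrel).2.1 (prelB_low hrel).2.2)
    have hi' := hcov hi
    rw [List.mem_toFinset, List.mem_map] at hi'
    obtain ⟨⟨i₀, t'⟩, hmem, hi₀⟩ := hi'
    simp only at hi₀
    subst hi₀
    have hlt : pheight6 t' < n := by have := pheight6_le_of_memL subs i₀ t' hmem; omega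
    exact ih t' hlt G (U.erase i₀) β X hβ hX (pnode6B_of_mem_forest subs U hforest i₀ t' hmem) b
      (vanish_erase_of_eq hb hbi) hlow hne r exc
  | split γ subs =>
    simp only [pnode6B, Bool.and_eq_true] at h
    obtain ⟨hsplit, hforest⟩ := h
    rw [pheight6] at ht
    obtain ⟨i, hi, hbi⟩ := exists_zero_of_psplitB f β hβ hsplit hb
      (by rw [hX]; exact hlow γ (psplitB_low hsplit).1 (psplitB_low hsplit).2)
    rw [List.mem_toFinset, List.mem_map] at hi
    obtain ⟨⟨i₀, t'⟩, hmem, hi₀⟩ := hi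
    simp only at hi₀
    subst hi₀
    have hlt : pheight6 t' < n := by have := pheight6_le_of_memL subs i₀ t' hmem; omega
    exact ih t' hlt G (U.erase i₀) β X hβ hX (pnode6B_of_mem_forest subs U hforest i₀ t' hmem) b
      (vanish_erase_of_eq hb hbi) hlow hne r exc

/-- **soundness of a v6 chart tree at the chart root**: every equimultiple reply `b` vanishing off `U` in the chart `j`
leads to a won position (or is impossible). OURS. [folklore] -/
theorem pnode6_sound
    (hrest : ∀ row ∈ rest, (∀ β : K, β ≠ 0 → ∀ (r : Fin 4 →₀ ℕ) (exc : Finset (Fin 4)),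
      RWins q localB (⟨spec f β (evalT row.1), r, exc⟩ : State K))) {β : K} (hβ : β ≠ 0) {L : Terms 5 k}
    {S : Finset (Fin 4)} {j : Fin 4} (r : Fin 4 →₀ ℕ) (exc : Finset (Fin 4)) (t : PNode6 k) (U : Finset (Fin 4))
    (h : pnode6B q rest (chartL q (S5 S) j.castSucc L) U t = true) (b : Fin 4 → K)
    (hb : ∀ m : Fin 4, m ∉ U → b m = 0) (heq : IsEquimultiplePoint q S j b (⟨spec f β (evalT L), r, exc⟩ : State K))
    (hne : (CentreBlowup.step q S j b (⟨spec f β (evalT L), r, exc⟩ : State K)).F ≠ 0) :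
    RWins q localB (CentreBlowup.step q S j b (⟨spec f β (evalT L), r, exc⟩ : State K)) := by
  set s' := CentreBlowup.step q S j b (⟨spec f β (evalT L), r, exc⟩ : State K) with hs'
  have hX : spec f β (evalT (chartL q (S5 S) j.castSucc L)) = chartTransform q S j (spec f β (evalT L)) :=
    (chartTransform_spec f β q S j L).symm
  have hF : s'.F = deletePthPowers q (PointBlowup.translate b (chartTransform q S j (spec f β (evalT L)))) :=
    DivClock.step_F_eq q S j b _
  have hlow : ∀ γ : Fin 4 → ℕ, γ ≠ 0 → (∑ i, γ i) < q →
      coeff (expo γ) (PointBlowup.translate b (chartTransform q S j (spec f β (evalT L)))) = 0 := fun γ h0 hdeg =>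
    heq (expo γ) ((not_congr (expo_eq_zero_iff γ)).mpr h0) (by rw [degree_expo]; exact hdeg)
  have hw := pnode6_sound_aux f hrest (pheight6 t + 1) t (Nat.lt_succ_self _) _ U β _ hβ hX h b hb hlow
    (by rw [← hF]; exact hne) s'.r s'.exc
  rw [← hF] at hw
  exact hw

end Tree

/-! ## §3 Rows, tables, entry point -/

/-- **soundness of one v6 row.** OURS. [folklore] -/
theorem pwin_of_prow6B {q : ℕ} (hq : 2 ≤ q) {rest : List (PRow6 k)}
    (hrest : ∀ row ∈ rest, (∀ β : K, β ≠ 0 → ∀ (r : Fin 4 →₀ ℕ) (exc : Finset (Fin 4)),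
      RWins q localB (⟨spec f β (evalT row.1), r, exc⟩ : State K))) {row : PRow6 k}
    (h : prow6B q rest row = true) :
    (∀ β : K, β ≠ 0 → ∀ (r : Fin 4 →₀ ℕ) (exc : Finset (Fin 4)),
      RWins q localB (⟨spec f β (evalT row.1), r, exc⟩ : State K)) := by
  obtain ⟨L, cert⟩ := row
  intro β hβ r exc
  cases cert with
  | blind c w α₀ a =>
    simp only [prow6B, Bool.and_eq_true] at h
    obtain ⟨htf, hblind⟩ := h
    refine Game.Wins.terminal fun _ hS => ?_
    have hns := WinCertAllFields.not_inCoordinateScope_map_of_blindB f hblind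
    rw [← spec_eq_map_trunc f β htf] at hns
    exact hns hS.1
  | coat m e₀ ex =>
    simp only [prow6B] at h
    exact Game.Wins.terminal fun _ hS => not_inCoordinateScope_of_pcoatB f hq h β hS.1
  | move S ch =>
    simp only [prow6B, Bool.and_eq_true, decide_eq_true_eq] at h
    obtain ⟨hperm, hall⟩ := h
    by_cases hsc : InCoordinateScope q (spec f β (evalT L))
    · refine Game.Wins.move (m := S) ⟨hsc, isPermissibleCentre_spec f β hperm⟩ ?_
      rintro s' ⟨j, b, hj, hbj, hloc, heq, hne, rfl⟩
      exact pnode6_sound f hrest hβ r exc (ch j) (S.erase j) (hall j hj) b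
        (vanish_erase K hbj ((localB_eq_true_iff S j b).mp hloc)) heq hne
    · exact Game.Wins.terminal fun _ hS' => hsc hS'.1

/-- **SOUNDNESS OF v6 CERTIFICATES**: every row of a checked table is certified. OURS. [folklore] -/
theorem pwin_of_pcert6B {q : ℕ} (hq : 2 ≤ q) : ∀ {T : List (PRow6 k)}, pcert6B q T = true → ∀ row ∈ T,
    (∀ β : K, β ≠ 0 → ∀ (r : Fin 4 →₀ ℕ) (exc : Finset (Fin 4)),
      RWins q localB (⟨spec f β (evalT row.1), r, exc⟩ : State K))
  | [], _ => fun row hrow => absurd hrow List.not_mem_nil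
  | row :: rest, h => by
    unfold pcert6B at h
    rw [Bool.and_eq_true] at h
    have hrest := pwin_of_pcert6B hq h.2
    intro r hr
    rcases List.mem_cons.mp hr with rfl | hr'
    · exact pwin_of_prow6B f hq hrest h.1
    · exact hrest r hr'

/-- **an `𝔽₃` state whose embedding heads a checked v6 table is a LOCAL A-win over EVERY field of characteristic 3.**
OURS. [folklore] -/
theorem rWins_liftState_of_pcert6B (L : Type) [Field L] [CharP L 3] [DecidableEq L] {s : SData 4 (ZMod 3)}
    {cert : PRowCert6 (ZMod 3)} {rest : List (PRow6 (ZMod 3))} (h : pcert6B 3 ((embed s.L, cert) :: rest) = true) :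
    RWins 3 localB (liftState L s.toState) := by
  have hw := pwin_of_pcert6B (φ3 L) (by norm_num) h (embed s.L, cert) List.mem_cons_self 1 one_ne_zero (expo s.r) s.exc
  rw [spec_embed] at hw
  exact hw

end LoopCLocal

end Summit.ResolutionOfSingularities.ResolutionOfSingularities.Theorems.PIDim4

end
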